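import Literature.NumberTheory.Transcendental.DiazMainIIISmallness
import Literature.NumberTheory.Transcendental.DiazMainIIIParams
import HarnessLib

/-!
# Laurent's Théorème 3 iii) — the smallness of the family at `θ` from bounds at level `X`

Topic `Literature/NumberTheory/Transcendental`. Fourth step of the conditional proof of the large
range of `Diaz1989_main_iii` (`DiazMain.lean`; M. Laurent, Astérisque 198–200 (1991), §3.1,
Théorème 3 iii); Diaz 1989 / Philippon 1986, Thm 2.12 (i)) from `Philippon1986_mainCriterion` and
`Philippon1986_GaGm`, after `DiazMainIIIConstruction.lean`, `DiazMainIIISmallness.lean` and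
`DiazMainIIIParams.lean`: the smallness `|Q_{l,t,j}(θ)| ≤ e^{-Ψ/2^{m+4}}` of every member of the
family at the TRUE point `θ = (y, x, e^{yx})`, reduced to three explicit numerical inequalities at
level `X` (the analogue of Diaz's §II-4-2, `DiazSmallness.small_of_bounds`, for the multiplicity
case; the bookkeeping is ours). Everything is PROVED; the definitions are explicit real expressions.

* `norm_coefPj_le` — `|P_{aμj}(θ')| ≤ 2^{(b-1)#Var}(#ExpIdx·H)A^{(b-1)#Var}` on `max|θ'_v| ≤ A`;
  `norm_aeval_Qj_sub_le` — the Lipschitz term `|Q(θ) - Q(θ')|` (`IntegerTaylor.norm_aeval_sub_aeval_le`);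
  `hermH_mono`, `hermH_nonneg` — monotonicity of the Hermite bound in its data.
* The constants of `(y, x)`: `X0s = ∑|x_k| + 1`, `Y0s`, `Abd = 2 + ∑_v|θ_v|`, `cbeta`, `omega0`,
  `KR`; and at level `X`: `Ccoef` (coefficients), `kapX` (twist), `Lam0` (product of distances),
  `epsJ` (jets), `Bgr` (growth on `|z| = K_R X²`), `Tdeg` (degrees), and the three terms `termA`
  (interpolation: `S!·[𝓗(ρ̄₁+1) + (B̄ + 𝓗(R))·q̄^{SM^m}]`), `termB` (twist on the large box), `termC`
  (Lipschitz).
* `small_of_bounds` — **if `termA, termB, termC ≤ e^{-Ψ/2^{m+4}}/3` and the six smallness conditions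
  on `ε_b = e^{-ρ}` hold at `X`, then for Siegel's unknowns `p`, every point `θ'` of the ball, every
  minimal index `j` at `θ'`, every `l ≤ M₂`, `t < S`: `|Q_{l,t,j}(θ)| ≤ e^{-Ψ/2^{m+4}}`** —
  `|Q(θ)| ≤ |Q(θ')| + |Q(θ) - Q(θ')|`, the first by `norm_aeval_Qj_le` with the data of the ball
  replaced monotonically by the constants (`X0s`, `Y0s`, `omega0`), the second by `norm_aeval_Qj_sub_le`.
  The eventual validity of the hypotheses as `X → ∞` is the object of the sequel.

## References

* M. Laurent, *Sur quelques résultats récents de transcendance*, Astérisque 198–200 (1991),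
  §3.1, Théorème 3 iii), p. 213. [Laurent1991]
* G. Diaz, *Grands degrés de transcendance pour des familles d'exponentielles*, J. Number Theory
  31 (1989), 1–23, §II-4-2, p. 15 (the model, without multiplicities). [Diaz1989]
-/

noncomputable section

open MvPolynomial Finset Finsupp Complex Filter Real
open scoped Polynomial
open Literature.NumberTheory.Transcendental.ExpGrid
open Literature.NumberTheory.Transcendental.Chudnovsky (wnorm wnorm_nonneg l1)
open Literature.NumberTheory.Transcendental.Taylor
open Literature.NumberTheory.Transcendental.Asymp
open Literature.NumberTheory.Transcendental.DiazThm1 (muv pts Separated scale_zero_eq_exp)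

namespace Literature.NumberTheory.Transcendental

namespace DiazMainIII

open Metric

variable {n m D L b : ℕ}

/-! ### Pointwise bounds at a point of the ball -/

/-- **The coefficients `P_{aμj}(θ')` on the polydisc `max |θ'_v| ≤ A`** (`A ≥ 1`): if `|p| ≤ H`
then `|P_{aμj}(θ')| ≤ 2^{(b-1)#Var} (#ExpIdx · H) A^{(b-1)#Var}`. [folklore] -/
theorem norm_coefPj_le (p : Unk n m D L b → ℤ) {H A : ℝ} (hH : ∀ w, |(p w : ℝ)| ≤ H) (hA : 1 ≤ A)
    {θ' : Var n m → ℂ} (hθ' : ∀ v, ‖θ' v‖ ≤ A) (j : Var n m →₀ ℕ) (am : AM n D L) :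
    ‖coefPj p θ' j am‖ ≤ 2 ^ ((b - 1) * Fintype.card (Var n m)) *
      (Fintype.card (ExpIdx n m b) * H) * A ^ ((b - 1) * Fintype.card (Var n m)) := by
  classical
  unfold coefPj
  refine (Chudnovsky.norm_aeval_le_l1 (Pj p am j) θ' hA hθ').trans ?_
  have h2 := l1_Pj_le p hH am j
  have h3 := totalDegree_Pj_le p am j
  have hl0 : 0 ≤ l1 (Pj p am j) := wnorm_nonneg _ _
  calc l1 (Pj p am j) * A ^ (Pj p am j).totalDegree
      ≤ (2 ^ ((b - 1) * Fintype.card (Var n m)) * (Fintype.card (ExpIdx n m b) * H)) *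
          A ^ ((b - 1) * Fintype.card (Var n m)) :=
        mul_le_mul h2 (pow_le_pow_right₀ hA h3) (by positivity) (hl0.trans h2)
    _ = _ := by ring

/-- **The Lipschitz term**: `|Q_{l,t,j}(θ) - Q_{l,t,j}(θ')| ≤ L(Q) · deg Q · A^{deg Q} · ε_b` on the
polydisc `max(|θ_v|, |θ'_v|) ≤ A`, `max |θ_v - θ'_v| ≤ ε_b` (`IntegerTaylor.norm_aeval_sub_aeval_le`),
with `L(Q)` and `deg Q` replaced by the bounds of `DiazMainIIIConstruction.lean`. [folklore] -/
theorem norm_aeval_Qj_sub_le (p : Unk n m D L b → ℤ) {H A εb : ℝ} (hH0 : 0 ≤ H)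
    (hH : ∀ w, |(p w : ℝ)| ≤ H) (hA : 1 ≤ A) (hεb : 0 ≤ εb) {θ θ' : Var n m → ℂ}
    (hθ : ∀ v, ‖θ v‖ ≤ A) (hθ' : ∀ v, ‖θ' v‖ ≤ A) (hdist : ∀ v, ‖θ v - θ' v‖ ≤ εb)
    {M' : ℕ} {l : Fin m → ℕ} (hl : ∀ k, l k < M') (t : ℕ) (j : Var n m →₀ ℕ) {Tdeg : ℕ}
    (hT : (b - 1) * Fintype.card (Var n m) + (t + D + n * m * L * M') ≤ Tdeg) :
    ‖aeval θ (Qj p l t j) - aeval θ' (Qj p l t j)‖ ≤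
      (Fintype.card (AM n D L) *
        ((2 ^ ((b - 1) * Fintype.card (Var n m)) * (Fintype.card (ExpIdx n m b) * H)) *
          (((D : ℝ) + n * L) ^ t * ((m : ℝ) * M' + 1) ^ D))) * Tdeg * A ^ Tdeg * εb := by
  classical
  have h1 := norm_aeval_sub_aeval_le (Qj p l t j) θ θ' hA hεb hθ hθ' hdist
  have hdeg := (totalDegree_Qj_le p hl t j).trans hT
  have hlen := l1_Qj_le p hH hl t j
  have hl0 : 0 ≤ l1 (Qj p l t j) := wnorm_nonneg _ _
  refine h1.trans ?_
  have hA0 : 0 ≤ A := zero_le_one.trans hA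
  have hdegR : ((Qj p l t j).totalDegree : ℝ) ≤ Tdeg := by exact_mod_cast hdeg
  have hpow : A ^ (Qj p l t j).totalDegree ≤ A ^ Tdeg := pow_le_pow_right₀ hA hdeg
  have hB0 : 0 ≤ (Fintype.card (AM n D L) : ℝ) *
      ((2 ^ ((b - 1) * Fintype.card (Var n m)) * (Fintype.card (ExpIdx n m b) * H)) *
        (((D : ℝ) + n * L) ^ t * ((m : ℝ) * M' + 1) ^ D)) := by positivity
  gcongr

/-- **Monotonicity of the Hermite bound** in `ε`, `r`, `t` and `1/Λ₀`. [folklore] -/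
theorem hermH_mono {N S : ℕ} {ε ε' r r' δ Λ₀ Λ₀' t t' : ℝ} (hε : 0 ≤ ε) (hεε : ε ≤ ε')
    (htr : 0 ≤ t + r) (h : t + r ≤ t' + r') (hδ : 0 < δ) (hΛ : 0 < Λ₀') (hΛΛ : Λ₀' ≤ Λ₀) :
    hermH N S ε r δ Λ₀ t ≤ hermH N S ε' r' δ Λ₀' t' := by
  unfold hermH
  have hΛ0 : 0 < Λ₀ := lt_of_lt_of_le hΛ hΛΛ
  have hε' : 0 ≤ ε' := hε.trans hεε
  have h2 : 0 ≤ 2 * (t' + r') := by linarith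
  have hNS : (0 : ℝ) ≤ (N : ℝ) * S := by positivity
  have hb0 : 0 ≤ (N : ℝ) * S * ε' := mul_nonneg hNS hε'
  have hc0 : 0 ≤ (N : ℝ) * S * ε' * (2 * (t' + r')) ^ (S * N) * (2 / δ) ^ S :=
    mul_nonneg (mul_nonneg hb0 (pow_nonneg h2 _)) (pow_nonneg (by positivity) _)
  gcongr

/-- `hermH ≥ 0` for nonnegative data. [folklore] -/
theorem hermH_nonneg {N S : ℕ} {ε r δ Λ₀ t : ℝ} (hε : 0 ≤ ε) (htr : 0 ≤ t + r) (hδ : 0 < δ)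
    (hΛ : 0 < Λ₀) : 0 ≤ hermH N S ε r δ Λ₀ t := by
  unfold hermH; positivity


/-! ### The constants attached to `(y, x)` and the three terms at level `X` -/

section Terms

variable {m' : ℕ}

/-- `X₀ = ∑|x_k| + 1`. [folklore] -/
def X0s (x : Fin (m' + 1) → ℂ) : ℝ := ∑ k, ‖x k‖ + 1

/-- `Y₀ = ∑|yᵢ| + 1`. [folklore] -/
def Y0s (y : Fin n → ℂ) : ℝ := ∑ i, ‖y i‖ + 1

/-- `A = 2 + ∑_v |θ_v|` (a common bound for the coordinates of the points of the ball). [folklore] -/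
def Abd (y : Fin n → ℂ) (x : Fin (m' + 1) → ℂ) : ℝ := 2 + ∑ v, ‖pt y x v‖

/-- `c_β(A) = 2(2A+1) + e^{A²+1}` (`norm_twistFactor_sub_one_le`). [folklore] -/
def cbeta (A : ℝ) : ℝ := 2 * (2 * A + 1) + Real.exp (A ^ 2 + 1)

/-- `ω₀ = min(1, |x_m|/4)` (a lower bound for `ω = min(1, |x̃_m|/2)` on the ball). [folklore] -/
def omega0 (x : Fin (m' + 1) → ℂ) : ℝ := min 1 (‖x (Fin.last m')‖ / 4)

/-- `K_R = (n+1) a_B X₀ + 2X₀ + 2`: the big radius is `R = K_R X²`. [folklore] -/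
def KR (n m' c : ℕ) (x : Fin (m' + 1) → ℂ) : ℝ :=
  ((n : ℝ) + 1) * aB n (m' + 1) c * X0s x + 2 * X0s x + 2

/-- The coefficient bound `C(X) = 2^{(b-1)#Var} (#ExpIdx · H) A^{(b-1)#Var}`. [folklore] -/
def Ccoef (n m' : ℕ) (A X : ℝ) : ℝ :=
  2 ^ ((bq n (m' + 1) X - 1) * Fintype.card (Var n (m' + 1))) *
    (Fintype.card (ExpIdx n (m' + 1) (bq n (m' + 1) X)) * Hgt3 n (m' + 1) X) *
      A ^ ((bq n (m' + 1) X - 1) * Fintype.card (Var n (m' + 1)))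

/-- The twist bound `κ(X) = 3 n m L M₂ c_β e^{-ρ}`. [folklore] -/
def kapX (n m' c : ℕ) (A X : ℝ) : ℝ :=
  3 * ((n : ℝ) * (m' + 1) * Lq n (m' + 1) X * M2q n (m' + 1) c X) * (cbeta A * Real.exp (-rho3 n (m' + 1) X))

/-- The lower bound `Λ̄₀ = (δ ω₀^M)^{M^{m-1}}`, `δ = e^{-C_xM}/2`, for the product of distances. [folklore] -/
def Lam0 (m' : ℕ) (x : Fin (m' + 1) → ℂ) (Cx X : ℝ) : ℝ :=
  (Real.exp (-(Cx * Mq X)) / 2 * omega0 x ^ Mq X) ^ (Mq X ^ m')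

/-- The jet bound `ε̄(X) = S! #AM C κ r̄^D e^{LY₀r̄}`, `r̄ = MX₀ + 1`. [folklore] -/
def epsJ (n m' c : ℕ) (y : Fin n → ℂ) (x : Fin (m' + 1) → ℂ) (A X : ℝ) : ℝ :=
  (Sq n (m' + 1) X).factorial * (Fintype.card (AM n (Dq n (m' + 1) X) (Lq n (m' + 1) X)) *
    (Ccoef n m' A X * kapX n m' c A X * (((Mq X : ℝ) * X0s x + 1) ^ Dq n (m' + 1) X *
      Real.exp (Lq n (m' + 1) X * Y0s y * ((Mq X : ℝ) * X0s x + 1)))))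

/-- The growth bound `B̄(X) = #AM C R^D e^{LY₀R}`, `R = K_R X²`. [folklore] -/
def Bgr (n m' c : ℕ) (y : Fin n → ℂ) (x : Fin (m' + 1) → ℂ) (A X : ℝ) : ℝ :=
  Fintype.card (AM n (Dq n (m' + 1) X) (Lq n (m' + 1) X)) *
    (Ccoef n m' A X * ((KR n m' c x * X ^ 2) ^ Dq n (m' + 1) X *
      Real.exp (Lq n (m' + 1) X * Y0s y * (KR n m' c x * X ^ 2))))

/-- **Term A** (interpolation): `S!·[𝓗(ρ̄₁+1) + (B̄ + 𝓗(R))·q̄^{SN}]`,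
`q̄ = (ρ̄₁ + 1 + r̄)/(R - r̄)`, `ρ̄₁ = M₂X₀`. [folklore] -/
def termA (n m' c : ℕ) (y : Fin n → ℂ) (x : Fin (m' + 1) → ℂ) (A Cx X : ℝ) : ℝ :=
  (Sq n (m' + 1) X).factorial *
    (hermH (Mq X ^ (m' + 1)) (Sq n (m' + 1) X) (epsJ n m' c y x A X) ((Mq X : ℝ) * X0s x + 1)
        (Real.exp (-(Cx * Mq X)) / 2) (Lam0 m' x Cx X) ((M2q n (m' + 1) c X : ℝ) * X0s x + 1) +
      (Bgr n m' c y x A X + hermH (Mq X ^ (m' + 1)) (Sq n (m' + 1) X) (epsJ n m' c y x A X)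
        ((Mq X : ℝ) * X0s x + 1) (Real.exp (-(Cx * Mq X)) / 2) (Lam0 m' x Cx X) (KR n m' c x * X ^ 2)) *
      ((((M2q n (m' + 1) c X : ℝ) * X0s x + 1) + ((Mq X : ℝ) * X0s x + 1)) /
        (KR n m' c x * X ^ 2 - ((Mq X : ℝ) * X0s x + 1))) ^ (Sq n (m' + 1) X * Mq X ^ (m' + 1)))

/-- **Term B** (the twist at the large box): `S!·#AM·C·κ·(ρ̄₁+1)^D e^{LY₀(ρ̄₁+1)}`. [folklore] -/
def termB (n m' c : ℕ) (y : Fin n → ℂ) (x : Fin (m' + 1) → ℂ) (A X : ℝ) : ℝ :=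
  (Sq n (m' + 1) X).factorial * (Fintype.card (AM n (Dq n (m' + 1) X) (Lq n (m' + 1) X)) *
    (Ccoef n m' A X * kapX n m' c A X * (((M2q n (m' + 1) c X : ℝ) * X0s x + 1) ^ Dq n (m' + 1) X *
      Real.exp (Lq n (m' + 1) X * Y0s y * ((M2q n (m' + 1) c X : ℝ) * X0s x + 1)))))

/-- The degree bound `T̄(X) = (b-1)#Var + (S + D + nmL(M₂+1))` for the members of the family.
[folklore] -/
def Tdeg (n m' c : ℕ) (X : ℝ) : ℕ :=
  (bq n (m' + 1) X - 1) * Fintype.card (Var n (m' + 1)) +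
    (Sq n (m' + 1) X + Dq n (m' + 1) X + n * (m' + 1) * Lq n (m' + 1) X * (M2q n (m' + 1) c X + 1))

/-- **Term C** (Lipschitz): `#AM (2^{(b-1)#Var} #ExpIdx H) (D+nL)^S (m(M₂+1)+1)^D · T̄ A^{T̄} e^{-ρ}`.
[folklore] -/
def termC (n m' c : ℕ) (A X : ℝ) : ℝ :=
  (Fintype.card (AM n (Dq n (m' + 1) X) (Lq n (m' + 1) X)) *
    ((2 ^ ((bq n (m' + 1) X - 1) * Fintype.card (Var n (m' + 1))) *
      (Fintype.card (ExpIdx n (m' + 1) (bq n (m' + 1) X)) * Hgt3 n (m' + 1) X)) *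
      ((((Dq n (m' + 1) X : ℕ) : ℝ) + n * Lq n (m' + 1) X) ^ Sq n (m' + 1) X *
        (((m' + 1 : ℕ) : ℝ) * (M2q n (m' + 1) c X + 1 : ℕ) + 1) ^ Dq n (m' + 1) X))) *
    Tdeg n m' c X * A ^ Tdeg n m' c X * Real.exp (-rho3 n (m' + 1) X)

end Terms


/-! ### The smallness at `θ` from the three terms -/

section SmallOfBounds

variable {m' : ℕ}

set_option maxHeartbeats 8000000 in
/-- **Smallness of the family at `θ`, from numerical bounds at level `X`.** Let `y` (frequencies)
and `x` (points, `x_m ≠ 0`, `δ₀`-separated at scale `M` with `δ₀ = e^{-C_xM}`) be given, `X ≥ 1`,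
`M ≥ 2`, `H ≥ 1`; assume the smallness conditions on `ε_b = e^{-ρ}` (`hε1`–`hε6`) and that the three
terms `termA`, `termB`, `termC` are each `≤ e^{-Ψ/2^{m+4}}/3`. Then for Siegel's unknowns `p`
(`|p| ≤ H`, `Q_{l,t} = 0` on `[0,M)^m × [0,S)`), every point `θ'` of the ball `max|θ'_v - θ_v| ≤ ε_b`,
every minimal index `j` at `θ'`, every `l ≤ M₂` and `t < S`:
`|Q_{l,t,j}(θ)| ≤ e^{-Ψ/2^{m+4}}`. Proof: `|Q(θ)| ≤ |Q(θ')| + |Q(θ) - Q(θ')|`; the first term is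
bounded by `norm_aeval_Qj_le` (with the coefficient bound `norm_coefPj_le`, the twist bound
`norm_kappa_sub_one_le`, the separation `separated_of_near`) and monotonicity in the data of the
ball (`hermH_mono`), giving `termA + termB`; the second by `norm_aeval_Qj_sub_le`, giving `termC`.
[cite: Diaz1989, §II-4-2 p. 15 (the model: "majoration de |Q_{μj}(θ)|", here with multiplicities)] -/
theorem small_of_bounds (y : Fin n → ℂ) (x : Fin (m' + 1) → ℂ) (hxlast : x (Fin.last m') ≠ 0)
    {Cx : ℝ} (hCx : 0 ≤ Cx) (c : ℕ) {X : ℝ} (hX : 1 ≤ X)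
    (hsep : Separated x (Mq X) (Real.exp (-(Cx * Mq X)))) (hM2 : 2 ≤ Mq X)
    (hH1 : 1 ≤ Hgt3 n (m' + 1) X)
    (hε1 : (2 * Abd y x + 1) * Real.exp (-rho3 n (m' + 1) X) ≤ 1)
    (hε2 : (n : ℝ) * (m' + 1) * Lq n (m' + 1) X * M2q n (m' + 1) c X *
      (cbeta (Abd y x) * Real.exp (-rho3 n (m' + 1) X)) ≤ 1)
    (hε3 : ((m' : ℝ) + 1) * Mq X * Real.exp (-rho3 n (m' + 1) X) ≤ Real.exp (-(Cx * Mq X)) / 2)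
    (hε4 : ((m' : ℝ) + 1) * Real.exp (-rho3 n (m' + 1) X) ≤ 1)
    (hε5 : (n : ℝ) * Real.exp (-rho3 n (m' + 1) X) ≤ 1)
    (hε6 : Real.exp (-rho3 n (m' + 1) X) ≤ ‖x (Fin.last m')‖ / 2)
    (hA : termA n m' c y x (Abd y x) Cx X ≤ Real.exp (-(Psi3 n (m' + 1) X / 2 ^ (m' + 5))) / 3)
    (hB : termB n m' c y x (Abd y x) X ≤ Real.exp (-(Psi3 n (m' + 1) X / 2 ^ (m' + 5))) / 3)
    (hC : termC n m' c (Abd y x) X ≤ Real.exp (-(Psi3 n (m' + 1) X / 2 ^ (m' + 5))) / 3)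
    (p : Unk n (m' + 1) (Dq n (m' + 1) X) (Lq n (m' + 1) X) (bq n (m' + 1) X) → ℤ)
    (hHb : ∀ w, |(p w : ℝ)| ≤ Hgt3 n (m' + 1) X)
    (hQ : ∀ l : Fin (m' + 1) → ℕ, (∀ k, l k < Mq X) → ∀ t < Sq n (m' + 1) X, Q p l t = 0)
    {θ' : Var n (m' + 1) → ℂ} (hball : ∀ v, ‖θ' v - pt y x v‖ ≤ Real.exp (-rho3 n (m' + 1) X))
    {j : Var n (m' + 1) →₀ ℕ} (hj : IsMinIdx p θ' j)
    {l : Fin (m' + 1) → ℕ} (hl : ∀ k, l k ≤ M2q n (m' + 1) c X) {t : ℕ} (ht : t < Sq n (m' + 1) X) :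
    ‖aeval (pt y x) (Qj p l t j)‖ ≤ Real.exp (-(Psi3 n (m' + 1) X / 2 ^ (m' + 5))) := by
  classical
  -- abbreviations
  set εb : ℝ := Real.exp (-rho3 n (m' + 1) X) with hεb
  set A : ℝ := Abd y x with hAdef
  set X0 : ℝ := X0s x with hX0def
  set Y0 : ℝ := Y0s y with hY0def
  set δ₀ : ℝ := Real.exp (-(Cx * (Mq X))) with hδ₀
  set C : ℝ := Ccoef n m' A X with hCdef
  set κ : ℝ := kapX n m' c A X with hκdef
  set Xs : ℝ := ∑ k, ‖xtil θ' k‖ with hXs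
  set Ys : ℝ := ∑ i, ‖ytil θ' i‖ with hYs
  set R : ℝ := KR n m' c x * X ^ 2 with hRdef
  have hεb0 : 0 < εb := Real.exp_pos _
  have hεb1 : εb ≤ 1 := by nlinarith
  -- the bound `A` for the coordinates
  have hsum : ∀ v, ‖pt y x v‖ ≤ A - 2 := fun v => by
    rw [hAdef, Abd]
    have := Finset.single_le_sum (f := fun v => ‖pt y x v‖) (fun v _ => norm_nonneg _) (Finset.mem_univ v)
    linarith
  have hA2 : 2 ≤ A := by
    rw [hAdef, Abd]
    have : 0 ≤ ∑ v, ‖pt y x v‖ := Finset.sum_nonneg fun _ _ => norm_nonneg _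
    linarith
  have hA1 : 1 ≤ A := by linarith
  have hθA : ∀ v, ‖pt y x v‖ ≤ A := fun v => by linarith [hsum v]
  have hθ'A : ∀ v, ‖θ' v‖ ≤ A := fun v => by
    have := norm_le_norm_add_norm_sub' (θ' v) (pt y x v)
    linarith [hsum v, hball v]
  have hyA : ∀ i, ‖y i‖ ≤ A := fun i => hθA (Sum.inl i)
  have hxA : ∀ k, ‖x k‖ ≤ A := fun k => hθA (Sum.inr (Sum.inl k))
  -- closeness of the data
  have hw : ∀ i k, ‖θ' (Sum.inr (Sum.inr (i, k))) - cexp (y i * x k)‖ ≤ εb := fun i k =>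
    hball (Sum.inr (Sum.inr (i, k)))
  have hy' : ∀ i, ‖ytil θ' i - y i‖ ≤ εb := fun i => hball (Sum.inl i)
  have hx' : ∀ k, ‖xtil θ' k - x k‖ ≤ εb := fun k => hball (Sum.inr (Sum.inl k))
  -- the twist
  have hκ0 : 0 ≤ κ := by rw [hκdef, kapX, cbeta]; positivity
  have hκ : ∀ μ : Fin n → ℕ, (∀ i, μ i < (Lq n (m' + 1) X)) → ∀ l' : Fin (m' + 1) → ℕ, (∀ k, l' k ≤ (M2q n (m' + 1) c X)) →
      ‖kappa θ' μ l' - 1‖ ≤ κ := by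
    intro μ hμ l' hl'
    have hε2' : (n : ℝ) * ((m' + 1 : ℕ) : ℝ) * (Lq n (m' + 1) X) * (M2q n (m' + 1) c X) *
        ((2 * (2 * A + 1) + Real.exp (A ^ 2 + 1)) * εb) ≤ 1 := by
      have := hε2; rw [cbeta] at this; push_cast at this ⊢; exact this
    have h := norm_kappa_sub_one_le θ' y x hA1 hεb0.le hεb1 hyA hxA hw hy' hx' hε1 hε2' hμ hl'
    refine h.trans (le_of_eq ?_)
    rw [hκdef, kapX, cbeta]; push_cast; ring
  -- separation of the perturbed points
  have hε3' : ((m' + 1 : ℕ) : ℝ) * (Mq X) * εb ≤ δ₀ / 2 := by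
    rw [hδ₀]; push_cast at hε3 ⊢; exact hε3
  have hsep' : Separated (xtil θ') (Mq X) (δ₀ / 2) := separated_of_near hsep hx' hε3'
  have hδ₀pos : 0 < δ₀ := Real.exp_pos _
  have hδ₀1 : δ₀ ≤ 1 := by
    rw [hδ₀, Real.exp_le_one_iff]
    have : (0 : ℝ) ≤ Cx * (Mq X) := by positivity
    linarith
  have hδpos : 0 < δ₀ / 2 := by positivity
  have hδ1 : δ₀ / 2 ≤ 1 := by linarith
  -- sizes of the perturbed data
  have hXs0 : 0 ≤ Xs := Finset.sum_nonneg fun _ _ => norm_nonneg _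
  have hYs0 : 0 ≤ Ys := Finset.sum_nonneg fun _ _ => norm_nonneg _
  have hXsle : Xs ≤ X0 := by
    rw [hXs, hX0def, X0s]
    have h1 : ∀ k, ‖xtil θ' k‖ ≤ ‖x k‖ + εb := fun k => by
      have := norm_le_norm_add_norm_sub' (xtil θ' k) (x k); linarith [hx' k]
    calc ∑ k, ‖xtil θ' k‖ ≤ ∑ k, (‖x k‖ + εb) := Finset.sum_le_sum fun k _ => h1 k
      _ = ∑ k, ‖x k‖ + ((m' + 1 : ℕ) : ℝ) * εb := by
          rw [Finset.sum_add_distrib]; simp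
      _ ≤ ∑ k, ‖x k‖ + 1 := by push_cast; linarith
  have hYsle : Ys ≤ Y0 := by
    rw [hYs, hY0def, Y0s]
    have h1 : ∀ i, ‖ytil θ' i‖ ≤ ‖y i‖ + εb := fun i => by
      have := norm_le_norm_add_norm_sub' (ytil θ' i) (y i); linarith [hy' i]
    calc ∑ i, ‖ytil θ' i‖ ≤ ∑ i, (‖y i‖ + εb) := Finset.sum_le_sum fun i _ => h1 i
      _ = ∑ i, ‖y i‖ + (n : ℝ) * εb := by rw [Finset.sum_add_distrib]; simp
      _ ≤ ∑ i, ‖y i‖ + 1 := by linarith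
  have hX01 : 1 ≤ X0 := by
    rw [hX0def, X0s]
    have : 0 ≤ ∑ k, ‖x k‖ := Finset.sum_nonneg fun _ _ => norm_nonneg _
    linarith
  have hY01 : 1 ≤ Y0 := by
    rw [hY0def, Y0s]
    have : 0 ≤ ∑ i, ‖y i‖ := Finset.sum_nonneg fun _ _ => norm_nonneg _
    linarith
  -- `ω ≥ ω₀ > 0` and the product bound
  have hω₀ : 0 < omega0 x := by
    unfold omega0
    exact lt_min one_pos (by have := norm_pos_iff.mpr hxlast; positivity)
  have hωge : omega0 x ≤ min 1 (‖xtil θ' (Fin.last m')‖ / 2) := by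
    unfold omega0
    refine min_le_min le_rfl ?_
    have := norm_sub_norm_le (x (Fin.last m')) (xtil θ' (Fin.last m'))
    rw [norm_sub_rev] at this
    linarith [hx' (Fin.last m')]
  have hΛbar : 0 < Lam0 m' x Cx X := by unfold Lam0; positivity
  have hΛle : Lam0 m' x Cx X ≤ (δ₀ / 2 * (min 1 (‖xtil θ' (Fin.last m')‖ / 2)) ^ (Mq X)) ^ ((Mq X) ^ m') := by
    unfold Lam0
    rw [← hδ₀]
    gcongr
  -- the coefficients
  have hC : ∀ am, ‖coefPj p θ' j am‖ ≤ C := fun am => by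
    rw [hCdef, Ccoef]
    exact norm_coefPj_le p hHb hA1 hθ'A j am
  have hH0 : 0 ≤ Hgt3 n (m' + 1) X := zero_le_one.trans hH1
  have hC0 : 0 ≤ C := by rw [hCdef, Ccoef]; positivity
  -- radii
  have hM1 : (1 : ℝ) ≤ (Mq X) := by exact_mod_cast (show 1 ≤ (Mq X) by omega)
  have hMM₂ : (Mq X) ≤ (M2q n (m' + 1) c X) := M_le_M2 X
  have hM₂r : ((Mq X) : ℝ) ≤ (M2q n (m' + 1) c X) := by exact_mod_cast hMM₂
  have haB1 : (1 : ℝ) ≤ aB n (m' + 1) c := by exact_mod_cast one_le_aB (n := n) (m := m' + 1) (c := c)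
  have hM₂le : ((M2q n (m' + 1) c X) : ℝ) ≤ ((n : ℝ) + 1) * aB n (m' + 1) c * X := by
    have : ((M2q n (m' + 1) c X) : ℝ) = ((n : ℝ) + 1) * aB n (m' + 1) c * Mq X := by
      rw [M2q, Bq]; push_cast; ring
    rw [this]
    exact mul_le_mul_of_nonneg_left (M_le (by linarith)) (by positivity)
  have hKR : KR n m' c x = ((n : ℝ) + 1) * aB n (m' + 1) c * X0 + 2 * X0 + 2 := by
    rw [KR, hX0def]
  have hX2 : X ≤ X ^ 2 := by nlinarith
  have hR1 : ((M2q n (m' + 1) c X) : ℝ) * Xs + 1 ≤ R := by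
    rw [hRdef, hKR]
    have h1 : ((M2q n (m' + 1) c X) : ℝ) * Xs ≤ ((n : ℝ) + 1) * aB n (m' + 1) c * X * X0 :=
      mul_le_mul hM₂le hXsle hXs0 (by positivity)
    nlinarith [mul_nonneg (mul_nonneg (by positivity : (0 : ℝ) ≤ ((n : ℝ) + 1) * aB n (m' + 1) c) (zero_le_one.trans hX01))
      (by linarith : (0 : ℝ) ≤ X ^ 2 - X)]
  have hR2 : ((Mq X) : ℝ) * Xs + 1 < R := by
    rw [hRdef, hKR]
    have h1 : ((Mq X) : ℝ) * Xs ≤ X * X0 := mul_le_mul (M_le (by linarith)) hXsle hXs0 (by linarith)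
    nlinarith [mul_nonneg (by positivity : (0 : ℝ) ≤ ((n : ℝ) + 1) * aB n (m' + 1) c * X0) (by positivity : (0:ℝ) ≤ X ^ 2)]
  -- the main analytic bound at `θ'`
  have hmain := norm_aeval_Qj_le p θ' j hM2 hMM₂ hQ hj hC0 hC hκ0 hκ hδpos hδ1 hsep' rfl rfl
    rfl rfl rfl rfl rfl hR1 hR2 hl t
  rw [← hXs, ← hYs] at hmain
  -- monotone replacement of the data of the ball by the constants `X₀, Y₀, ω₀`
  have hr0 : 0 ≤ (Mq X : ℝ) * Xs + 1 := by positivity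
  have hrle : (Mq X : ℝ) * Xs + 1 ≤ (Mq X : ℝ) * X0 + 1 := by
    have := mul_le_mul_of_nonneg_left hXsle (Nat.cast_nonneg (Mq X))
    linarith
  have hρle : (M2q n (m' + 1) c X : ℝ) * Xs ≤ (M2q n (m' + 1) c X : ℝ) * X0 :=
    mul_le_mul_of_nonneg_left hXsle (Nat.cast_nonneg _)
  have hρ0 : 0 ≤ (M2q n (m' + 1) c X : ℝ) * Xs := by positivity
  have hLr : (Lq n (m' + 1) X : ℝ) * Ys * ((Mq X : ℝ) * Xs + 1) ≤
      (Lq n (m' + 1) X : ℝ) * Y0 * ((Mq X : ℝ) * X0 + 1) :=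
    mul_le_mul (mul_le_mul_of_nonneg_left hYsle (Nat.cast_nonneg _)) hrle hr0 (by positivity)
  have hεj0 : 0 ≤ ((Sq n (m' + 1) X).factorial : ℝ) * (Fintype.card (AM n (Dq n (m' + 1) X) (Lq n (m' + 1) X)) *
      (C * κ * (((Mq X : ℝ) * Xs + 1) ^ Dq n (m' + 1) X *
        Real.exp ((Lq n (m' + 1) X : ℝ) * Ys * ((Mq X : ℝ) * Xs + 1))))) := by positivity
  have hεjle : ((Sq n (m' + 1) X).factorial : ℝ) * (Fintype.card (AM n (Dq n (m' + 1) X) (Lq n (m' + 1) X)) *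
      (C * κ * (((Mq X : ℝ) * Xs + 1) ^ Dq n (m' + 1) X *
        Real.exp ((Lq n (m' + 1) X : ℝ) * Ys * ((Mq X : ℝ) * Xs + 1))))) ≤ epsJ n m' c y x A X := by
    rw [epsJ, ← hCdef, ← hκdef, ← hX0def, ← hY0def]
    gcongr
  have hRr : (Mq X : ℝ) * X0 + 1 < R := by
    rw [hRdef, hKR]
    have h1 : (Mq X : ℝ) * X0 ≤ X * X0 := mul_le_mul_of_nonneg_right (M_le (by linarith)) (by linarith)
    nlinarith [mul_nonneg (by positivity : (0 : ℝ) ≤ ((n : ℝ) + 1) * aB n (m' + 1) c * X0) (by positivity : (0:ℝ) ≤ X ^ 2)]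
  have hH₁ := hermH_mono (N := Mq X ^ (m' + 1)) (S := Sq n (m' + 1) X) (δ := δ₀ / 2) hεj0 hεjle
    (r := (Mq X : ℝ) * Xs + 1) (r' := (Mq X : ℝ) * X0 + 1)
    (t := (M2q n (m' + 1) c X : ℝ) * Xs + 1) (t' := (M2q n (m' + 1) c X : ℝ) * X0 + 1)
    (by linarith) (by linarith) hδpos hΛbar hΛle
  have hHR := hermH_mono (N := Mq X ^ (m' + 1)) (S := Sq n (m' + 1) X) (δ := δ₀ / 2) hεj0 hεjle
    (r := (Mq X : ℝ) * Xs + 1) (r' := (Mq X : ℝ) * X0 + 1)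
    (t := R) (t' := R) (by linarith) (by linarith) hδpos hΛbar hΛle
  have hBle : (Fintype.card (AM n (Dq n (m' + 1) X) (Lq n (m' + 1) X)) : ℝ) *
      (C * (R ^ Dq n (m' + 1) X * Real.exp ((Lq n (m' + 1) X : ℝ) * Ys * R))) ≤ Bgr n m' c y x A X := by
    rw [Bgr, ← hCdef, ← hRdef, ← hY0def]
    have hR0 : 0 ≤ R := (hr0.trans_lt hR2).le
    gcongr
  have hq0 : 0 ≤ ((M2q n (m' + 1) c X : ℝ) * Xs + 1 + ((Mq X : ℝ) * Xs + 1)) / (R - ((Mq X : ℝ) * Xs + 1)) :=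
    div_nonneg (by positivity) (by linarith)
  have hqle : ((M2q n (m' + 1) c X : ℝ) * Xs + 1 + ((Mq X : ℝ) * Xs + 1)) / (R - ((Mq X : ℝ) * Xs + 1)) ≤
      ((M2q n (m' + 1) c X : ℝ) * X0 + 1 + ((Mq X : ℝ) * X0 + 1)) / (R - ((Mq X : ℝ) * X0 + 1)) := by
    have hden : 0 < R - ((Mq X : ℝ) * X0 + 1) := by linarith
    calc ((M2q n (m' + 1) c X : ℝ) * Xs + 1 + ((Mq X : ℝ) * Xs + 1)) / (R - ((Mq X : ℝ) * Xs + 1))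
        ≤ ((M2q n (m' + 1) c X : ℝ) * Xs + 1 + ((Mq X : ℝ) * Xs + 1)) / (R - ((Mq X : ℝ) * X0 + 1)) :=
          div_le_div_of_nonneg_left (by linarith) hden (by linarith)
      _ ≤ ((M2q n (m' + 1) c X : ℝ) * X0 + 1 + ((Mq X : ℝ) * X0 + 1)) / (R - ((Mq X : ℝ) * X0 + 1)) :=
          div_le_div_of_nonneg_right (by linarith) hden.le
  have htS : (t.factorial : ℝ) ≤ (Sq n (m' + 1) X).factorial := by exact_mod_cast Nat.factorial_le ht.le
  have hH₁0 : 0 ≤ hermH (Mq X ^ (m' + 1)) (Sq n (m' + 1) X) (epsJ n m' c y x A X) ((Mq X : ℝ) * X0 + 1)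
      (δ₀ / 2) (Lam0 m' x Cx X) ((M2q n (m' + 1) c X : ℝ) * X0 + 1) :=
    hermH_nonneg (hεj0.trans hεjle) (by nlinarith [mul_nonneg (Nat.cast_nonneg (M2q n (m' + 1) c X)) (zero_le_one.trans hX01), mul_nonneg (Nat.cast_nonneg (Mq X)) (zero_le_one.trans hX01)]) hδpos hΛbar
  have hHR0 : 0 ≤ hermH (Mq X ^ (m' + 1)) (Sq n (m' + 1) X) (epsJ n m' c y x A X) ((Mq X : ℝ) * X0 + 1)
      (δ₀ / 2) (Lam0 m' x Cx X) R :=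
    hermH_nonneg (hεj0.trans hεjle) (by nlinarith [mul_nonneg (Nat.cast_nonneg (Mq X)) (zero_le_one.trans hX01)]) hδpos hΛbar
  have hBgr0 : 0 ≤ Bgr n m' c y x A X := by
    rw [Bgr, ← hCdef, ← hRdef]
    have hR0 : 0 ≤ R := (hr0.trans_lt hR2).le
    positivity
  -- first part `≤ termA`, second `≤ termB`
  have hin0 : 0 ≤      (hermH (Mq X ^ (m' + 1)) (Sq n (m' + 1) X)
          (((Sq n (m' + 1) X).factorial : ℝ) * (Fintype.card (AM n (Dq n (m' + 1) X) (Lq n (m' + 1) X)) *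
            (C * κ * (((Mq X : ℝ) * Xs + 1) ^ Dq n (m' + 1) X *
              Real.exp ((Lq n (m' + 1) X : ℝ) * Ys * ((Mq X : ℝ) * Xs + 1))))))
          ((Mq X : ℝ) * Xs + 1) (δ₀ / 2)
          ((δ₀ / 2 * (min 1 (‖xtil θ' (Fin.last m')‖ / 2)) ^ Mq X) ^ (Mq X ^ m'))
          ((M2q n (m' + 1) c X : ℝ) * Xs + 1) +
        ((Fintype.card (AM n (Dq n (m' + 1) X) (Lq n (m' + 1) X)) : ℝ) *
            (C * (R ^ Dq n (m' + 1) X * Real.exp ((Lq n (m' + 1) X : ℝ) * Ys * R))) +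
          hermH (Mq X ^ (m' + 1)) (Sq n (m' + 1) X)
            (((Sq n (m' + 1) X).factorial : ℝ) * (Fintype.card (AM n (Dq n (m' + 1) X) (Lq n (m' + 1) X)) *
              (C * κ * (((Mq X : ℝ) * Xs + 1) ^ Dq n (m' + 1) X *
                Real.exp ((Lq n (m' + 1) X : ℝ) * Ys * ((Mq X : ℝ) * Xs + 1))))))
            ((Mq X : ℝ) * Xs + 1) (δ₀ / 2)
            ((δ₀ / 2 * (min 1 (‖xtil θ' (Fin.last m')‖ / 2)) ^ Mq X) ^ (Mq X ^ m')) R) *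
        (((M2q n (m' + 1) c X : ℝ) * Xs + 1 + ((Mq X : ℝ) * Xs + 1)) / (R - ((Mq X : ℝ) * Xs + 1))) ^
          (Sq n (m' + 1) X * Mq X ^ (m' + 1))) := by
    have h1 := hermH_nonneg (N := Mq X ^ (m' + 1)) (S := Sq n (m' + 1) X) hεj0 (t := (M2q n (m' + 1) c X : ℝ) * Xs + 1) (r := (Mq X : ℝ) * Xs + 1) (by linarith) hδpos (lt_of_lt_of_le hΛbar hΛle)
    have h2 := hermH_nonneg (N := Mq X ^ (m' + 1)) (S := Sq n (m' + 1) X) hεj0 (t := R) (r := (Mq X : ℝ) * Xs + 1) (by linarith) hδpos (lt_of_lt_of_le hΛbar hΛle)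
    have h3 : 0 ≤ (Fintype.card (AM n (Dq n (m' + 1) X) (Lq n (m' + 1) X)) : ℝ) *
        (C * (R ^ Dq n (m' + 1) X * Real.exp ((Lq n (m' + 1) X : ℝ) * Ys * R))) := by
      have hR0 : 0 ≤ R := (hr0.trans_lt hR2).le
      positivity
    have h4 := pow_nonneg hq0 (Sq n (m' + 1) X * Mq X ^ (m' + 1))
    nlinarith [mul_nonneg (add_nonneg h3 h2) h4]
  have hinle :      (hermH (Mq X ^ (m' + 1)) (Sq n (m' + 1) X)
          (((Sq n (m' + 1) X).factorial : ℝ) * (Fintype.card (AM n (Dq n (m' + 1) X) (Lq n (m' + 1) X)) *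
            (C * κ * (((Mq X : ℝ) * Xs + 1) ^ Dq n (m' + 1) X *
              Real.exp ((Lq n (m' + 1) X : ℝ) * Ys * ((Mq X : ℝ) * Xs + 1))))))
          ((Mq X : ℝ) * Xs + 1) (δ₀ / 2)
          ((δ₀ / 2 * (min 1 (‖xtil θ' (Fin.last m')‖ / 2)) ^ Mq X) ^ (Mq X ^ m'))
          ((M2q n (m' + 1) c X : ℝ) * Xs + 1) +
        ((Fintype.card (AM n (Dq n (m' + 1) X) (Lq n (m' + 1) X)) : ℝ) *
            (C * (R ^ Dq n (m' + 1) X * Real.exp ((Lq n (m' + 1) X : ℝ) * Ys * R))) +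
          hermH (Mq X ^ (m' + 1)) (Sq n (m' + 1) X)
            (((Sq n (m' + 1) X).factorial : ℝ) * (Fintype.card (AM n (Dq n (m' + 1) X) (Lq n (m' + 1) X)) *
              (C * κ * (((Mq X : ℝ) * Xs + 1) ^ Dq n (m' + 1) X *
                Real.exp ((Lq n (m' + 1) X : ℝ) * Ys * ((Mq X : ℝ) * Xs + 1))))))
            ((Mq X : ℝ) * Xs + 1) (δ₀ / 2)
            ((δ₀ / 2 * (min 1 (‖xtil θ' (Fin.last m')‖ / 2)) ^ Mq X) ^ (Mq X ^ m')) R) *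
        (((M2q n (m' + 1) c X : ℝ) * Xs + 1 + ((Mq X : ℝ) * Xs + 1)) / (R - ((Mq X : ℝ) * Xs + 1))) ^
          (Sq n (m' + 1) X * Mq X ^ (m' + 1))) ≤
      (hermH (Mq X ^ (m' + 1)) (Sq n (m' + 1) X) (epsJ n m' c y x A X) ((Mq X : ℝ) * X0 + 1)
          (δ₀ / 2) (Lam0 m' x Cx X) ((M2q n (m' + 1) c X : ℝ) * X0 + 1) +
        (Bgr n m' c y x A X + hermH (Mq X ^ (m' + 1)) (Sq n (m' + 1) X) (epsJ n m' c y x A X)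
          ((Mq X : ℝ) * X0 + 1) (δ₀ / 2) (Lam0 m' x Cx X) R) *
        (((M2q n (m' + 1) c X : ℝ) * X0 + 1 + ((Mq X : ℝ) * X0 + 1)) / (R - ((Mq X : ℝ) * X0 + 1))) ^
          (Sq n (m' + 1) X * Mq X ^ (m' + 1))) := by
    have h3 : 0 ≤ (Fintype.card (AM n (Dq n (m' + 1) X) (Lq n (m' + 1) X)) : ℝ) *
        (C * (R ^ Dq n (m' + 1) X * Real.exp ((Lq n (m' + 1) X : ℝ) * Ys * R))) := by
      have hR0 : 0 ≤ R := (hr0.trans_lt hR2).le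
      positivity
    have h2 := hermH_nonneg (N := Mq X ^ (m' + 1)) (S := Sq n (m' + 1) X) hεj0 (t := R) (r := (Mq X : ℝ) * Xs + 1) (by linarith) hδpos (lt_of_lt_of_le hΛbar hΛle)
    gcongr
  have hpartA : (t.factorial : ℝ) *      (hermH (Mq X ^ (m' + 1)) (Sq n (m' + 1) X)
          (((Sq n (m' + 1) X).factorial : ℝ) * (Fintype.card (AM n (Dq n (m' + 1) X) (Lq n (m' + 1) X)) *
            (C * κ * (((Mq X : ℝ) * Xs + 1) ^ Dq n (m' + 1) X *
              Real.exp ((Lq n (m' + 1) X : ℝ) * Ys * ((Mq X : ℝ) * Xs + 1))))))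
          ((Mq X : ℝ) * Xs + 1) (δ₀ / 2)
          ((δ₀ / 2 * (min 1 (‖xtil θ' (Fin.last m')‖ / 2)) ^ Mq X) ^ (Mq X ^ m'))
          ((M2q n (m' + 1) c X : ℝ) * Xs + 1) +
        ((Fintype.card (AM n (Dq n (m' + 1) X) (Lq n (m' + 1) X)) : ℝ) *
            (C * (R ^ Dq n (m' + 1) X * Real.exp ((Lq n (m' + 1) X : ℝ) * Ys * R))) +
          hermH (Mq X ^ (m' + 1)) (Sq n (m' + 1) X)
            (((Sq n (m' + 1) X).factorial : ℝ) * (Fintype.card (AM n (Dq n (m' + 1) X) (Lq n (m' + 1) X)) *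
              (C * κ * (((Mq X : ℝ) * Xs + 1) ^ Dq n (m' + 1) X *
                Real.exp ((Lq n (m' + 1) X : ℝ) * Ys * ((Mq X : ℝ) * Xs + 1))))))
            ((Mq X : ℝ) * Xs + 1) (δ₀ / 2)
            ((δ₀ / 2 * (min 1 (‖xtil θ' (Fin.last m')‖ / 2)) ^ Mq X) ^ (Mq X ^ m')) R) *
        (((M2q n (m' + 1) c X : ℝ) * Xs + 1 + ((Mq X : ℝ) * Xs + 1)) / (R - ((Mq X : ℝ) * Xs + 1))) ^
          (Sq n (m' + 1) X * Mq X ^ (m' + 1))) ≤ termA n m' c y x A Cx X := by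
    calc (t.factorial : ℝ) *      (hermH (Mq X ^ (m' + 1)) (Sq n (m' + 1) X)
          (((Sq n (m' + 1) X).factorial : ℝ) * (Fintype.card (AM n (Dq n (m' + 1) X) (Lq n (m' + 1) X)) *
            (C * κ * (((Mq X : ℝ) * Xs + 1) ^ Dq n (m' + 1) X *
              Real.exp ((Lq n (m' + 1) X : ℝ) * Ys * ((Mq X : ℝ) * Xs + 1))))))
          ((Mq X : ℝ) * Xs + 1) (δ₀ / 2)
          ((δ₀ / 2 * (min 1 (‖xtil θ' (Fin.last m')‖ / 2)) ^ Mq X) ^ (Mq X ^ m'))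
          ((M2q n (m' + 1) c X : ℝ) * Xs + 1) +
        ((Fintype.card (AM n (Dq n (m' + 1) X) (Lq n (m' + 1) X)) : ℝ) *
            (C * (R ^ Dq n (m' + 1) X * Real.exp ((Lq n (m' + 1) X : ℝ) * Ys * R))) +
          hermH (Mq X ^ (m' + 1)) (Sq n (m' + 1) X)
            (((Sq n (m' + 1) X).factorial : ℝ) * (Fintype.card (AM n (Dq n (m' + 1) X) (Lq n (m' + 1) X)) *
              (C * κ * (((Mq X : ℝ) * Xs + 1) ^ Dq n (m' + 1) X *
                Real.exp ((Lq n (m' + 1) X : ℝ) * Ys * ((Mq X : ℝ) * Xs + 1))))))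
            ((Mq X : ℝ) * Xs + 1) (δ₀ / 2)
            ((δ₀ / 2 * (min 1 (‖xtil θ' (Fin.last m')‖ / 2)) ^ Mq X) ^ (Mq X ^ m')) R) *
        (((M2q n (m' + 1) c X : ℝ) * Xs + 1 + ((Mq X : ℝ) * Xs + 1)) / (R - ((Mq X : ℝ) * Xs + 1))) ^
          (Sq n (m' + 1) X * Mq X ^ (m' + 1)))
        ≤ ((Sq n (m' + 1) X).factorial : ℝ) *      (hermH (Mq X ^ (m' + 1)) (Sq n (m' + 1) X)
          (((Sq n (m' + 1) X).factorial : ℝ) * (Fintype.card (AM n (Dq n (m' + 1) X) (Lq n (m' + 1) X)) *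
            (C * κ * (((Mq X : ℝ) * Xs + 1) ^ Dq n (m' + 1) X *
              Real.exp ((Lq n (m' + 1) X : ℝ) * Ys * ((Mq X : ℝ) * Xs + 1))))))
          ((Mq X : ℝ) * Xs + 1) (δ₀ / 2)
          ((δ₀ / 2 * (min 1 (‖xtil θ' (Fin.last m')‖ / 2)) ^ Mq X) ^ (Mq X ^ m'))
          ((M2q n (m' + 1) c X : ℝ) * Xs + 1) +
        ((Fintype.card (AM n (Dq n (m' + 1) X) (Lq n (m' + 1) X)) : ℝ) *
            (C * (R ^ Dq n (m' + 1) X * Real.exp ((Lq n (m' + 1) X : ℝ) * Ys * R))) +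
          hermH (Mq X ^ (m' + 1)) (Sq n (m' + 1) X)
            (((Sq n (m' + 1) X).factorial : ℝ) * (Fintype.card (AM n (Dq n (m' + 1) X) (Lq n (m' + 1) X)) *
              (C * κ * (((Mq X : ℝ) * Xs + 1) ^ Dq n (m' + 1) X *
                Real.exp ((Lq n (m' + 1) X : ℝ) * Ys * ((Mq X : ℝ) * Xs + 1))))))
            ((Mq X : ℝ) * Xs + 1) (δ₀ / 2)
            ((δ₀ / 2 * (min 1 (‖xtil θ' (Fin.last m')‖ / 2)) ^ Mq X) ^ (Mq X ^ m')) R) *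
        (((M2q n (m' + 1) c X : ℝ) * Xs + 1 + ((Mq X : ℝ) * Xs + 1)) / (R - ((Mq X : ℝ) * Xs + 1))) ^
          (Sq n (m' + 1) X * Mq X ^ (m' + 1))) := mul_le_mul_of_nonneg_right htS hin0
      _ ≤ _ := mul_le_mul_of_nonneg_left hinle (by positivity)
      _ = termA n m' c y x A Cx X := by rw [termA, ← hX0def, ← hδ₀, ← hRdef]
  have hpartB : (t.factorial : ℝ) * ((Fintype.card (AM n (Dq n (m' + 1) X) (Lq n (m' + 1) X)) : ℝ) *
      (C * κ * (((M2q n (m' + 1) c X : ℝ) * Xs + 1) ^ Dq n (m' + 1) X *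
        Real.exp ((Lq n (m' + 1) X : ℝ) * Ys * ((M2q n (m' + 1) c X : ℝ) * Xs + 1))))) ≤ termB n m' c y x A X := by
    rw [termB, ← hCdef, ← hκdef, ← hX0def, ← hY0def]
    gcongr
  -- the Lipschitz term `≤ termC`
  have hdist : ∀ v, ‖pt y x v - θ' v‖ ≤ εb := fun v => by rw [norm_sub_rev]; exact hball v
  have hl' : ∀ k, l k < M2q n (m' + 1) c X + 1 := fun k => Nat.lt_succ_of_le (hl k)
  have hT : (bq n (m' + 1) X - 1) * Fintype.card (Var n (m' + 1)) +
      (t + Dq n (m' + 1) X + n * (m' + 1) * Lq n (m' + 1) X * (M2q n (m' + 1) c X + 1)) ≤ Tdeg n m' c X := by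
    unfold Tdeg; omega
  have hlip := norm_aeval_Qj_sub_le p hH0 hHb hA1 hεb0.le hθA hθ'A hdist hl' t j hT
  have hS1 : 1 ≤ Sq n (m' + 1) X := by omega
  have hDL1 : (1 : ℝ) ≤ (Dq n (m' + 1) X : ℝ) + n * Lq n (m' + 1) X := by
    have hD1 : 1 ≤ Dq n (m' + 1) X := by
      unfold Dq; exact Nat.mul_le_mul one_le_aD hS1 |>.trans' (by simp)
    have : (1 : ℝ) ≤ Dq n (m' + 1) X := by exact_mod_cast hD1
    have : (0 : ℝ) ≤ n * Lq n (m' + 1) X := by positivity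
    linarith
  have hpartC : (Fintype.card (AM n (Dq n (m' + 1) X) (Lq n (m' + 1) X)) *
        ((2 ^ ((bq n (m' + 1) X - 1) * Fintype.card (Var n (m' + 1))) *
          (Fintype.card (ExpIdx n (m' + 1) (bq n (m' + 1) X)) * Hgt3 n (m' + 1) X)) *
          ((((Dq n (m' + 1) X : ℕ) : ℝ) + n * Lq n (m' + 1) X) ^ t *
            ((((m' + 1 : ℕ) : ℝ)) * (M2q n (m' + 1) c X + 1 : ℕ) + 1) ^ Dq n (m' + 1) X))) *
        Tdeg n m' c X * A ^ Tdeg n m' c X * εb ≤ termC n m' c A X := by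
    rw [termC, ← hεb]
    gcongr
  -- assemble
  have hsplit := norm_le_norm_add_norm_sub' (aeval (pt y x) (Qj p l t j)) (aeval θ' (Qj p l t j))
  have h3 : Real.exp (-(Psi3 n (m' + 1) X / 2 ^ (m' + 5))) =
      Real.exp (-(Psi3 n (m' + 1) X / 2 ^ (m' + 5))) / 3 + Real.exp (-(Psi3 n (m' + 1) X / 2 ^ (m' + 5))) / 3 +
        Real.exp (-(Psi3 n (m' + 1) X / 2 ^ (m' + 5))) / 3 := by ring
  rw [h3]
  linarith [hmain, hpartA, hpartB, hpartC, hlip, hsplit, hA, hB, hC]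

end SmallOfBounds

end DiazMainIII

end Literature.NumberTheory.Transcendental

end
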